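import Summits.QuantumFields.YangMills.Theorems.BalabanUVNodesN22WindowSoftTwoPointDomSys
import Literature.MathematicalPhysics.QuantumFieldTheory.Balaban1983to89.Node00.Record8Inhabited

/-!
# NODE N22 (NE9) — THE SOFT-LOCALIZED ROAD, A6 SMOKE TEST: the two CAPSTONES FIRE at the zero probe chart `ρ = 0` (every windowed kernel vanishes,
# dag-n23-b's `Node00.Record8Inhabited.polWindow_zeroChart`), for EVERY family of cluster towers `S`, EVERY reading map `emb`, EVERY window `W`

Cell `pub-ymgap`, Track A (HUMAN RULING D-0062), WIDTH SEAT `dag-n22-w2` (g2) on node n22 = NE9; `--kind proof --supports stmt-QuantumFields-20544 --as helper`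
(K3⁷ `SpineGivenEndpointR13SepCoPH`), COUNT-NEUTRAL; THEOREMS ONLY (0 `def`, 0 `sorry`, standard axioms).  Fourth storey of this seat's soft road
(`…N22WindowSoftTwoPoint` p597403 → `…Torus` p598467 → `…DomSys` p599486 → this).  Director-ym №189 (A6): «a theorem whose hypotheses are uninhabited is VACUOUS —
inhabit your antecedent in the same file or label the filing LOCATED».  The capstones `windowedNE9_localizedSum_of_softSum` ∕ `windowedDecay_localizedSum_of_softSum`
carry the per-term soft majorants and module J29's Σ-bounds as DISPLAYED hypotheses (LOCATED at the record: NODE A ∕ NODE O ∕ J-road).  THIS FILE certifies that the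
hypothesis SHAPES are jointly satisfiable and that the composition elaborates END TO END, by firing both capstones at a MODEL: the zero probe chart `ρ = 0` of the
cheap Stage-8 inhabitant (dag-n23-b), at which `polWindow F K j ℰ 0 bV μ ν z = 0` for every term functional — so the Σ-bounds hold with the zero summands `a := 0`, the
majorants with `C_E := 0`, for ANY family of towers `S : (K : ℕ) → W1.ClusterTower (F.P K) 𝔸 (L^{m′})`, ANY reading maps, ANY window and ANY nonnegative moduli `Λ`;
numerics `δ₀ := 1`, `κ := 2κ₀(64, 8)`.

HONEST (binding).  A DEGENERATE witness (the zero chart is not print's `su(N) ↪ M_N(ℂ)` chart `θ.ρ8`; at the record the hypotheses are NOT claimed); it certifies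
non-vacuity of the binder shapes only.  Nothing of Bałaban's asserted; N22 NOT discharged (typed 28∕28 · discharged 5∕27 UNCHANGED); K3⁷ OPEN, not claimed; no count
claim; one finite 𝕋⁴ programme at fixed ε — R4 closes the CONDITIONAL rung `BalabanLadder.UV` only; the YM mass gap (Clay) is NOT proved by any of this.
-/

noncomputable section

open Filter Topology
open scoped BigOperators

namespace YMDAG.N22.WindowSoftTwoPoint

open Literature.MathematicalPhysics.QuantumFieldTheory.Balaban1983to89
open Literature.MathematicalPhysics.QuantumFieldTheory.Balaban1983to89.T4Continuum (T4Family)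
open Literature.MathematicalPhysics.QuantumFieldTheory.Balaban1983to89.Node00 (polWindow)
open Literature.MathematicalPhysics.QuantumFieldTheory.Balaban1983to89.Node00.LocalizedSum17 (localizedSum ReadingMaps)
open Literature.MathematicalPhysics.QuantumFieldTheory.Balaban1983to89.Node00.W1 (ClusterTower)
open Literature.MathematicalPhysics.QuantumFieldTheory.Balaban1983to89.Node00.U3KernelLetters (WindowedNE9 WindowedDecay)
open Literature.MathematicalPhysics.QuantumFieldTheory.Balaban1983to89.Node00.Record8Inhabited (polWindow_zeroChart)
open Literature.MathematicalPhysics.QuantumFieldTheory.Balaban1983to89.B12Decay510 (delta1)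
open Literature.MathematicalPhysics.QuantumFieldTheory.Balaban1983to89.B12Decay510Window (K₁)
open Literature.MathematicalPhysics.QuantumFieldTheory.Balaban1983to89.B12TreeDecay (K₀ kappa₀ kappa₀_nonneg)

variable {𝔄 : Type*} [NormedRing 𝔄] [NormedAlgebra ℝ 𝔄] {V : Type*} [NormedAddCommGroup V] [NormedSpace ℝ V] {ι : Type*} [Fintype ι]
variable (F : T4Family)

/-- Numerics of the smoke test: `κ := 2κ₀(64,8)` satisfies the tree-leaf threshold `κ₀(64,8) ≤ κ∕2`. -/
theorem kappa_smoke_le : kappa₀ (4 * 2 ^ 4) (2 * 4) ≤ 2 * kappa₀ (4 * 2 ^ 4) (2 * 4) / 2 := by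
  linarith

/-- ★ **A6 — THE `WindowedNE9` CAPSTONE FIRES AT THE ZERO PROBE CHART**: for every cube exponent `m′`, every family of cluster towers `S`, every reading maps `emb`, every
colour basis `bV`, every window `W` and all nonnegative moduli `Λ`, the hypotheses of `windowedNE9_localizedSum_of_softSum` hold at `ρ = 0` with `a := 0`, `C_E := 0`,
`δ₀ := 1`, `κ := 2κ₀(64,8)` (both windowed kernels vanish: `polWindow_zeroChart`), and the capstone yields
`WindowedNE9 F (localizedSum F S emb) 0 bV W δ₁ (0·…·Λ)`.  Degenerate, declared. -/
theorem windowedNE9_localizedSum_of_softSum_fires_zeroChart (m' : ℕ) {𝔸 : Type*} [NeZero (F.L ^ m')]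
    (S : (K : ℕ) → ClusterTower (F.P K) 𝔸 (F.L ^ m')) (emb : ReadingMaps F 𝔄 𝔸) (bV : Module.Basis ι ℝ V) (W : Set (ℕ → ℝ))
    (Λm : ℕ → ℕ → ℝ) (hΛ : ∀ k i, 0 ≤ Λm k i) :
    WindowedNE9 F (localizedSum F S emb) (0 : V →L[ℝ] 𝔄) bV W (delta1 1 (2 * kappa₀ (4 * 2 ^ 4) (2 * 4)) (((F.L ^ m' : ℕ) : ℝ) * 4))
      (fun k i => 0 * Real.exp (delta1 1 (2 * kappa₀ (4 * 2 ^ 4) (2 * 4)) (((F.L ^ m' : ℕ) : ℝ) * 4) * (((F.L ^ m' : ℕ) : ℝ) * 4) * 3) *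
        K₀ (4 * 2 ^ 4) (2 * 4) * K₁ 4 (1 / 2) * Λm k i) :=
  windowedNE9_localizedSum_of_softSum F m' (F.L ^ m') rfl S emb 0 bV W Λm hΛ le_rfl one_pos (kappa_smoke_le)
    (fun _ _ _ _ _ _ _ _ => 0)
    (fun g _ g' _ k μ ν z K => by
      rw [polWindow_zeroChart, polWindow_zeroChart, sub_self, abs_zero, Finset.sum_const_zero])
    (fun g _ g' _ k μ ν z K X => by simp only [zero_mul]; exact le_rfl)

/-- ★ **A6 — THE `WindowedDecay` CAPSTONE FIRES AT THE ZERO PROBE CHART** likewise (value side: `b := 0`, `C_E := 0`, `w := 0`):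
`WindowedDecay F (localizedSum F S emb) 0 bV W μ ν δ₁` for every `S`, `emb`, `bV`, `W`, `μ`, `ν`.  Degenerate, declared. -/
theorem windowedDecay_localizedSum_of_softSum_fires_zeroChart (m' : ℕ) {𝔸 : Type*} [NeZero (F.L ^ m')]
    (S : (K : ℕ) → ClusterTower (F.P K) 𝔸 (F.L ^ m')) (emb : ReadingMaps F 𝔄 𝔸) (bV : Module.Basis ι ℝ V) (W : Set (ℕ → ℝ)) (μ ν : Fin 4) :
    WindowedDecay F (localizedSum F S emb) (0 : V →L[ℝ] 𝔄) bV W μ ν (delta1 1 (2 * kappa₀ (4 * 2 ^ 4) (2 * 4)) (((F.L ^ m' : ℕ) : ℝ) * 4)) :=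
  windowedDecay_localizedSum_of_softSum F m' (F.L ^ m') rfl S emb 0 bV W (w := 0) le_rfl le_rfl one_pos (kappa_smoke_le) μ ν
    (fun _ _ _ _ _ => 0)
    (fun g _ k z K => by rw [polWindow_zeroChart, abs_zero, Finset.sum_const_zero])
    (fun g _ k z K X => by simp only [zero_mul, mul_zero]; exact le_rfl)

end YMDAG.N22.WindowSoftTwoPoint

end
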